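import Literature.MathematicalPhysics.QuantumFieldTheory.BalabanImbrieJaffe1984to88.BIJ88GaussShellInterpolated309

/-!
# `BalabanImbrieJaffe1984to88.BIJ88GaussShellSum309` — T. Bałaban, J. Imbrie, A. Jaffe, *Effective action and cluster properties of the
abelian Higgs model*, Commun. Math. Phys. **114** (1988) 257–315 [BalabanImbrieJaffe1988]: p. 307 [PDF 51] L5–11 (Sect. 5.13: *"Functional
derivatives hitting χ-factors farther than ½r(e_k) from Λ₁₀^{(k)c} produce factors e^{−cp(e_k)²} after integrating with respect to A^{(k)″},
φ^{(k)″}. These derivatives are supported at |A^{(k)″}| ≥ cp(e_k) or |φ^{(k)″}| ≥ cp(e_k) … Thus we can use the arguments at the end of Sect. 14 in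
[3] to extract the factors e^{−cp(e_k)²} from the Gaussian measure"*) and p. 309 [PDF 53] L26–28 (*"After integration over A^{(k)}, we obtain
factors ct^{−n}e^{−cp(te_k)²}"*) — **THE SHELL BOUND UNDER `⟨·⟩_{s,X}` FOR A FACTOR DOMINATED BY A SUM OF SHELL INDICATORS, EACH TERM WITH ITS
OWN SET OF HIT χ-SLOTS**.

`BIJ88GaussShellInterpolated309.abs_gexp_prec_le_shell` integrates `|G| ≤ M·1{a_b ≤ |Φ_b(ext ω)| ∀ b ∈ B′}` for ONE family `B′`.  In the walk
form (5.13.3) the functional derivatives (legs) of a term land on χ-slots that vary with the term (end data `E`, slot assignment `g`), and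
EVERY hit χ-factor — differentiated in `t` or by a leg — is supported in its shell (print: *"These derivatives are supported at |A^{(k)″}| ≥
cp(e_k)"*).  THIS FILE integrates a bound of the form `|G(ω)| ≤ Σ_{t∈T} M_t·1{a_b ≤ |Φ_b(ext ω)| ∀ b ∈ hit(t)}(ω)` TERM BY TERM:
* §1 `abs_gexp_le_sum_of_indicator` — `|⟨G⟩| ≤ Σ_t M_t·Law(S_t)` (the translated Gaussian law of `BIJ88GaussShellInterpolated309` §1);
* §2 `frame_restrict`, `sum_sq_restrict` — the frame letter `|Σ_bθ_bΦ_b(φ)| ≤ Λ‖θ‖₂‖φ‖₂` of an ambient family `B₀` passes to every sub-family;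
* §3 **`abs_gexp_prec_le_sum_shell`** — `|⟨G⟩_{s,X}| ≤ Σ_{t∈T} M_t · Π_{b∈hit(t)} 2e^{−a_b(a_b−2ΛF/m)/(2Λ²/m)}` for every `s ∈ [0,1]^I`, `Δ ≥ m`,
  `‖ℱ|_X‖₂ ≤ F`, hit sets `hit(t) ⊆ B₀` — one Gaussian shell factor per HIT χ-slot of each term.

statement-level skeleton of published theorems with citation tags; proofs where landed; nothing here is a claim about the Yang–Mills mass gap

PDF held: `paper:balaban1988-cmp114-bij-abelian-higgs-effective-action` (journal page = PDF page + 256); pages re-read this session as text: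
PDF 51 (p. 307) L2–20, PDF 53 (p. 309) L21–28.

CITATION HEADER (lean-in-tree rule).  Part of the lit-balaban TYPED SKELETON (HOME `run/shared/lean/pub/lit-balaban/`), Phase 2, seat p36
(gen 22, unit `lit-balaban-p36`); rows **C2.Eq5.14.3-5.14.4** (member: §f estimate E4a′ — the Gaussian shell step for term-dependent hit sets)
and C2.Eq5.13.3-5.13.4 (member) of `HOME/lit-balaban-r16/ROWS-C2-part2.md` (owner r16, referee ref-5).  Theorem-only; no definitions, no `Prop`
facts; axioms standard.
HONEST SCOPE.  The Chebyshev/Chernoff shell route of `BIJ88GaussMultiShell307`/`BIJ88GaussShellInterpolated309` (not [3] § 14, which is not held);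
linear slot fields; the frame letter `Λ`, the coercivity `m`, the source bound `F` and the thresholds `a_b` are inputs.

REVISION (doc-only, referee/owner items N-ref1-g107-2 / N-ref1-g115-1 / D-owner-v2.389): the p. 307 L5–13 quotation above now carries print's region symbols
`Λ₁₀^{(k)c}` / `Λ₁₁^{(k)}` and *"χ′-factors"* where applicable; no declaration changed.
-/

namespace Literature.MathematicalPhysics.QuantumFieldTheory.BalabanImbrieJaffe1984to88.BIJ88GaussShellSum309

open MeasureTheory ProbabilityTheory Finset Matrix
open scoped BigOperators
open Literature.MathematicalPhysics.QuantumFieldTheory.Balaban1983to89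
open B2Eq228Conditioning (gaussProb isProbabilityMeasure_gaussProb)
open BIJ88TruncationConnected306 (gexp)
open BIJ88PolymerRep5134Gauss (ext prec src)
open BIJ88SlotFieldGaussBounds (ext_dotProduct_ext)
open BIJ88GaussShellInterpolated309 (gexp_eq_integral_map isProbabilityMeasure_shift shift_real_forall_abs_ge_le prec_posDef_of_mem_cube
  dotProduct_prec_mulVec_ge_of_mem_cube)

/-! ## §1  `|⟨G⟩| ≤ Σ_t M_t·Law(S_t)` when `|G| ≤ Σ_t M_t·1_{S_t}` -/

section Generic

variable {n : Type} [Fintype n] [DecidableEq n] {A : Matrix n n ℝ}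

/-- **`|⟨G⟩| ≤ Σ_{t∈T} M_t · Law(S_t)` when `|G| ≤ Σ_{t∈T} M_t·1_{S_t}`** (`S_t` measurable; `Law` = the centred Gaussian of covariance `A⁻¹`
translated by `A⁻¹f`, `BIJ88GaussShellInterpolated309.gexp_eq_integral_map`): each term of a sum of shell-supported bounds is integrated
separately. [cite: BalabanImbrieJaffe1988, §5.13 p.307] -/
theorem abs_gexp_le_sum_of_indicator (hA : A.PosDef) (f : n → ℝ) {η : Type*} (T : Finset η) {G : (n → ℝ) → ℝ} {S : η → Set (n → ℝ)}
    (hS : ∀ t ∈ T, MeasurableSet (S t)) {M : η → ℝ} (hG : ∀ ω, |G ω| ≤ ∑ t ∈ T, M t * (S t).indicator 1 ω) :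
    |gexp A f G| ≤ ∑ t ∈ T, M t * ((gaussProb A).map fun z => z + A⁻¹ *ᵥ f).real (S t) := by
  haveI := isProbabilityMeasure_gaussProb hA
  haveI := isProbabilityMeasure_shift (μ := gaussProb A) (A⁻¹ *ᵥ f)
  rw [gexp_eq_integral_map hA f G]
  refine abs_integral_le_integral_abs.trans ?_
  have hint : ∀ t ∈ T, Integrable (fun ω => M t * (S t).indicator (1 : (n → ℝ) → ℝ) ω) ((gaussProb A).map fun z => z + A⁻¹ *ᵥ f) :=
    fun t ht => ((integrable_const (1 : ℝ)).indicator (hS t ht)).const_mul (M t)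
  calc ∫ ω, |G ω| ∂((gaussProb A).map fun z => z + A⁻¹ *ᵥ f)
      ≤ ∫ ω, ∑ t ∈ T, M t * (S t).indicator 1 ω ∂((gaussProb A).map fun z => z + A⁻¹ *ᵥ f) :=
        integral_mono_of_nonneg (Filter.Eventually.of_forall fun ω => abs_nonneg _) (integrable_finsetSum T hint)
          (Filter.Eventually.of_forall hG)
    _ = ∑ t ∈ T, M t * ((gaussProb A).map fun z => z + A⁻¹ *ᵥ f).real (S t) := by
        rw [integral_finsetSum T hint]
        exact sum_congr rfl fun t ht => by rw [integral_const_mul, integral_indicator_one (hS t ht)]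

/-! ## §2  The frame letter passes to sub-families -/

omit [Fintype n] [DecidableEq n] in
/-- extending coefficients on a sub-family by zero does not change the sum of squares. [cite: BalabanImbrieJaffe1988, §5.13 p.307] -/
theorem sum_sq_restrict {κ₀ : Type*} [Fintype κ₀] [DecidableEq κ₀] (H : Finset κ₀) (θ : ↥H → ℝ) :
    ∑ k, (fun k => if h : k ∈ H then θ ⟨k, h⟩ else 0) k ^ 2 = ∑ k : ↥H, θ k ^ 2 := by
  rw [← Finset.sum_subset (subset_univ H) fun k _ hk => by simp [hk], ← Finset.sum_attach]
  exact sum_congr rfl fun k _ => by simp [k.2]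

omit [DecidableEq n] in
/-- **the frame letter of the ambient family restricts**: `|Σ_{k∈H} θ_kℓ_k(ω)| ≤ Λ‖θ‖₂‖ω‖₂` for every sub-family `H ⊆ κ₀`, from the same letter
for all of `κ₀` (extend `θ` by zero). [cite: BalabanImbrieJaffe1988, §5.13 p.307] -/
theorem frame_restrict {κ₀ : Type*} [Fintype κ₀] [DecidableEq κ₀] {ℓ : κ₀ → (n → ℝ) → ℝ} {Λ : ℝ}
    (hframe : ∀ (θ : κ₀ → ℝ) (ω : n → ℝ), |∑ k, θ k * ℓ k ω| ≤ Λ * Real.sqrt (∑ k, θ k ^ 2) * Real.sqrt (ω ⬝ᵥ ω))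
    (H : Finset κ₀) (θ : ↥H → ℝ) (ω : n → ℝ) :
    |∑ k : ↥H, θ k * ℓ k.1 ω| ≤ Λ * Real.sqrt (∑ k : ↥H, θ k ^ 2) * Real.sqrt (ω ⬝ᵥ ω) := by
  have h := hframe (fun k => if h : k ∈ H then θ ⟨k, h⟩ else 0) ω
  have hsum : ∑ k, (fun k => if h : k ∈ H then θ ⟨k, h⟩ else 0) k * ℓ k ω = ∑ k : ↥H, θ k * ℓ k.1 ω := by
    rw [← Finset.sum_subset (subset_univ H) fun k _ hk => by simp [hk], ← Finset.sum_attach H]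
    exact sum_congr rfl fun k _ => by simp [k.2]
  rwa [hsum, sum_sq_restrict H θ] at h

end Generic

/-! ## §3  The located data: one shell factor per hit χ-slot of each term -/

section Located

variable {α I : Type} [Fintype α] [DecidableEq α] [Fintype I] [DecidableEq I] (blk : α → I) (Δ : Matrix α α ℝ) (ℱ : α → ℝ)
variable {ι : Type*} (B₀ : Finset ι) {Φ : ι → (α → ℝ) → ℝ}

/-- **`|⟨G⟩_{s,X}| ≤ Σ_{t∈T} M_t · Π_{b∈hit(t)} 2e^{−a_b(a_b−2ΛF/m)/(2Λ²/m)}`, UNIFORMLY IN `s ∈ [0,1]^I`**, whenever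
`|G(ω)| ≤ Σ_{t∈T} M_t · 1{a_b ≤ |Φ_b(ext ω)| for all b ∈ hit(t)}(ω)` with `M_t ≥ 0` and hit sets `hit(t)` inside an ambient family `B₀` of linear
slot fields carrying the frame letter `|Σ_bθ_bΦ_b(φ)| ≤ Λ‖θ‖₂‖φ‖₂`; `Δ ≻ 0`, `Δ ≥ m > 0`, `‖ℱ|_X‖₂ ≤ F`, `a_b ≥ 0` — EVERY HIT χ-SLOT OF EVERY
TERM PAYS ITS OWN GAUSSIAN SHELL FACTOR (p. 307: functional derivatives hitting χ-factors *"produce factors e^{−cp(e_k)²}"*; p. 309: *"After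
integration over A^{(k)}, we obtain factors ct^{−n}e^{−cp(te_k)²}"*). [cite: BalabanImbrieJaffe1988, §5.13 p.307, (5.14.4) p.309] -/
theorem abs_gexp_prec_le_sum_shell [DecidableEq ι] (hΔ : Δ.PosDef) {m : ℝ} (hm : 0 < m)
    (hΔm : ∀ φ : α → ℝ, m * (φ ⬝ᵥ φ) ≤ φ ⬝ᵥ (Δ *ᵥ φ)) {s : I → ℝ} (hs : ∀ i, 0 ≤ s i ∧ s i ≤ 1) (X : Finset I)
    (hlin : ∀ b ∈ B₀, IsLinearMap ℝ (Φ b)) {Λ : ℝ} (hΛ : 0 < Λ)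
    (hframe : ∀ (θ : ↥B₀ → ℝ) (φ : α → ℝ), |∑ b : ↥B₀, θ b * Φ b φ| ≤ Λ * Real.sqrt (∑ b : ↥B₀, θ b ^ 2) * Real.sqrt (φ ⬝ᵥ φ))
    {F : ℝ} (hF0 : 0 ≤ F) (hF : src blk ℱ X ⬝ᵥ src blk ℱ X ≤ F ^ 2) {a : ↥B₀ → ℝ} (ha : ∀ b, 0 ≤ a b)
    {η : Type*} (T : Finset η) (hit : η → Finset ↥B₀) {M : η → ℝ} (hM : ∀ t ∈ T, 0 ≤ M t)
    {G : ({x : α // blk x ∈ X} → ℝ) → ℝ}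
    (hG : ∀ ω, |G ω| ≤ ∑ t ∈ T, M t *
      {ω : {x : α // blk x ∈ X} → ℝ | ∀ b ∈ hit t, a b ≤ |Φ b (ext blk X ω)|}.indicator 1 ω) :
    |gexp (prec blk Δ X s) (src blk ℱ X) G| ≤
      ∑ t ∈ T, M t * ∏ b ∈ hit t, 2 * Real.exp (-(a b * (a b - 2 * (Λ * F / m)) / (2 * (Λ ^ 2 / m)))) := by
  -- the slot fields read on the fields of `X` are linear with the same frame letter
  have hℓ : ∀ b : ↥B₀, IsLinearMap ℝ fun ω : {x : α // blk x ∈ X} → ℝ => Φ b (ext blk X ω) := fun b =>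
    ⟨fun ω ω' => by rw [(BIJ88EffectiveActionGauss308.isLinearMap_ext blk X).map_add, (hlin b b.2).map_add],
      fun r ω => by rw [(BIJ88EffectiveActionGauss308.isLinearMap_ext blk X).map_smul, (hlin b b.2).map_smul]⟩
  have hframe' : ∀ (θ : ↥B₀ → ℝ) (ω : {x : α // blk x ∈ X} → ℝ),
      |∑ b : ↥B₀, θ b * Φ b (ext blk X ω)| ≤ Λ * Real.sqrt (∑ b : ↥B₀, θ b ^ 2) * Real.sqrt (ω ⬝ᵥ ω) := fun θ ω => by
    rw [← ext_dotProduct_ext blk X ω ω]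
    exact hframe θ (ext blk X ω)
  have hcont : ∀ b : ↥B₀, Continuous fun ω : {x : α // blk x ∈ X} → ℝ => Φ b (ext blk X ω) := fun b =>
    ((hℓ b).mk' _).continuous_of_finiteDimensional
  -- the hit events are measurable
  have hS : ∀ t ∈ T, MeasurableSet {ω : {x : α // blk x ∈ X} → ℝ | ∀ b ∈ hit t, a b ≤ |Φ b (ext blk X ω)|} := by
    intro t _
    have h1 : {ω : {x : α // blk x ∈ X} → ℝ | ∀ b ∈ hit t, a b ≤ |Φ b (ext blk X ω)|} =
        ⋂ b ∈ hit t, {ω | a b ≤ |Φ b (ext blk X ω)|} := by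
      ext ω
      simp only [Set.mem_setOf_eq, Set.mem_iInter]
    rw [h1]
    exact MeasurableSet.biInter (hit t).countable_toSet fun b _ =>
      measurableSet_le measurable_const (continuous_abs.measurable.comp (hcont b).measurable)
  refine (abs_gexp_le_sum_of_indicator (prec_posDef_of_mem_cube blk Δ hΔ hs X) (src blk ℱ X) T hS hG).trans
    (sum_le_sum fun t ht => mul_le_mul_of_nonneg_left ?_ (hM t ht))
  -- the translated law of the hit event of the term `t`: the multi-shell bound for the sub-family `hit t`
  have hev : {ω : {x : α // blk x ∈ X} → ℝ | ∀ b ∈ hit t, a b ≤ |Φ b (ext blk X ω)|} =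
      {ω | ∀ k : ↥(hit t), a k.1 ≤ |Φ k.1 (ext blk X ω)|} := by
    ext ω
    simp only [Set.mem_setOf_eq, Subtype.forall]
  rw [hev, ← prod_coe_sort (hit t)]
  exact shift_real_forall_abs_ge_le (prec_posDef_of_mem_cube blk Δ hΔ hs X) hm (dotProduct_prec_mulVec_ge_of_mem_cube blk Δ hΔm hs X)
    (src blk ℱ X) (ℓ := fun (k : ↥(hit t)) ω => Φ k.1 (ext blk X ω)) (fun k => hℓ k.1) hΛ
    (fun θ ω => frame_restrict hframe' (hit t) θ ω) hF0 hF (a := fun k : ↥(hit t) => a k.1) fun k => ha k.1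

end Located

end Literature.MathematicalPhysics.QuantumFieldTheory.BalabanImbrieJaffe1984to88.BIJ88GaussShellSum309
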